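import Summits.FinalStateConjecture.FinalStateConjecture.Theorems.EIHFluxBalanceInertialRecessionStubEndgameOracleTight

/-!
# Route EIHFluxBalance — crux `InertialRecession`, line `sublinear-is-free-clean-window-charges`:
# the increment oracle for the WHOLE system when it is compact at scale `t` (one window of radius `c₀s`)

Helper file for the crux `stmt-FinalStateConjecture-10166`
(`Summit.FinalStateConjecture.FinalStateConjecture.Theses.EIHFluxBalance.InertialRecession`), registered stub
`stub_pairwiseDichotomy` / `stub_incrementOracle` (lead reshapes r7/r9) of
`Cruxes/InertialRecession/Lines/sublinear_is_free_clean_window_charges.lean`; companion of `…OracleTightIncrement` for the member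
set `S = univ` (no outsider): with the radius `R(s) = c₀s`, `c₀ = (κ−κ²)/2`, every body within `c₀s/2` of the reference and
`ρ ≤ c₀s/2`, the total energy and momentum change by at most `C·2c₀^{-3/2}t₁^{-1/2} + ζ(t₁) + ζ(t₂)` (`univ_increment`).
-/

noncomputable section

set_option linter.dupNamespace false

open Filter Topology Set MeasureTheory intervalIntegral
open scoped Topology BigOperators

namespace Summit.FinalStateConjecture.FinalStateConjecture.Theorems.SublinearIsFree.Oracle

open Literature.Geometry.Lorentzian
open Summit.FinalStateConjecture.FinalStateConjecture.Theorems.SublinearIsFree.Endgame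

/-- **THE INCREMENT ORACLE FOR THE WHOLE SYSTEM, COMPACT AT SCALE `t`.** See the module docstring. [folklore] -/
theorem univ_increment {N : ℕ} (M : Fin N → ℝ) (ξ v : Fin N → ℝ → E3) (κ : ℝ) (P : ℝ → E3 → ℝ → Fin 4 → ℝ)
    (ρ : ℝ → ℝ) (C T T' T₀ : ℝ) (ζ : ℝ → ℝ)
    (hWL : ∀ (t₁ t₂ : ℝ) (c : ℝ → E3) (R : ℝ → ℝ), T ≤ t₁ → t₁ ≤ t₂ →
      (∀ s ∈ Set.Icc t₁ t₂, ∀ s' ∈ Set.Icc t₁ t₂, ‖c s - c s'‖ ≤ 2 * |s - s'| ∧ |R s - R s'| ≤ 2 * |s - s'|) →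
      (∀ s ∈ Set.Icc t₁ t₂, ρ s ≤ (1 / 2) * R s ∧ ‖c s‖ + R s ≤ (κ + κ ^ 2) / 2 * s ∧
        ∀ j, ‖ξ j s - c s‖ ≤ (1 - 1 / 2) * R s ∨ (1 + 1 / 2) * R s ≤ ‖ξ j s - c s‖) →
      ∀ μ : Fin 4, |P t₂ (c t₂) (R t₂) μ - P t₁ (c t₁) (R t₁) μ| ≤ C * ∫ s in t₁..t₂, (R s ^ (3 / 2 : ℝ))⁻¹)
    (hID : ∀ (t : ℝ) (c : E3) (R : ℝ) (A : Finset (Fin N)), T' ≤ t → ρ t ≤ (1 / 2) * R →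
      ‖c‖ + R ≤ (κ + κ ^ 2) / 2 * t →
      (∀ j, ‖ξ j t - c‖ ≤ (1 - 1 / 2) * R ∨ (1 + 1 / 2) * R ≤ ‖ξ j t - c‖) →
      (∀ j, j ∈ A ↔ ‖ξ j t - c‖ ≤ (1 - 1 / 2) * R) →
      |P t c R 0 - ∑ j ∈ A, M j * (√(1 - ‖v j t‖ ^ 2))⁻¹| ≤ ζ t ∧
      ∀ k : Fin 3, |P t c R k.succ - ∑ j ∈ A, M j * (√(1 - ‖v j t‖ ^ 2))⁻¹ * v j t k| ≤ ζ t)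
    (hC : 0 ≤ C) (hκ0 : 0 < κ) (hκ1 : κ < 1)
    (hdiff : ∀ i, Differentiable ℝ (ξ i)) (hspeed : ∀ i s, T₀ ≤ s → ‖deriv (ξ i) s‖ ≤ 2)
    (a : Fin N) {t₁ t₂ : ℝ} (hT : T ≤ t₁) (hT' : T' ≤ t₁) (hT₀ : T₀ ≤ t₁) (ht₁ : 0 < t₁) (h12 : t₁ ≤ t₂)
    (hcone : ∀ s ∈ Set.Icc t₁ t₂, ‖ξ a s‖ ≤ κ ^ 2 * s)
    (hρ : ∀ s ∈ Set.Icc t₁ t₂, ρ s ≤ (κ - κ ^ 2) / 2 * s / 2)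
    (htight : ∀ s ∈ Set.Icc t₁ t₂, ∀ i, ‖ξ i s - ξ a s‖ ≤ (κ - κ ^ 2) / 2 * s / 2) :
    |∑ j, M j * (√(1 - ‖v j t₂‖ ^ 2))⁻¹ - ∑ j, M j * (√(1 - ‖v j t₁‖ ^ 2))⁻¹| ≤
        C * (2 * (((κ - κ ^ 2) / 2) ^ (3 / 2 : ℝ))⁻¹ * (t₁ ^ (1 / 2 : ℝ))⁻¹) + ζ t₁ + ζ t₂ ∧
    ∀ k : Fin 3, |∑ j, M j * (√(1 - ‖v j t₂‖ ^ 2))⁻¹ * v j t₂ k - ∑ j, M j * (√(1 - ‖v j t₁‖ ^ 2))⁻¹ * v j t₁ k| ≤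
        C * (2 * (((κ - κ ^ 2) / 2) ^ (3 / 2 : ℝ))⁻¹ * (t₁ ^ (1 / 2 : ℝ))⁻¹) + ζ t₁ + ζ t₂ := by
  classical
  set c₀ : ℝ := (κ - κ ^ 2) / 2 with hc₀def
  have hκκ : 0 < κ - κ ^ 2 := by nlinarith
  have hc₀ : 0 < c₀ := by positivity
  set R : ℝ → ℝ := fun s ↦ c₀ * s with hR
  have hRpos : ∀ s ∈ Set.Icc t₁ t₂, 0 < R s := fun s hs ↦ mul_pos hc₀ (ht₁.trans_le hs.1)
  have hRlip : ∀ s ∈ Set.Icc t₁ t₂, ∀ s' ∈ Set.Icc t₁ t₂, |R s - R s'| ≤ 2 * |s - s'| := by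
    intro s _ s' _
    simp only [hR]
    rw [← mul_sub, abs_mul, abs_of_pos hc₀]
    have hc₀1 : c₀ ≤ 2 := by rw [hc₀def]; nlinarith
    have := abs_nonneg (s - s')
    nlinarith
  have hcap : ∀ s ∈ Set.Icc t₁ t₂, ‖ξ a s‖ + R s ≤ (κ + κ ^ 2) / 2 * s := by
    intro s hs
    have := hcone s hs
    have hid : κ ^ 2 * s + c₀ * s = (κ + κ ^ 2) / 2 * s := by rw [hc₀def]; ring
    simp only [hR]; linarith
  have hinc := increment_of_windowPath M ξ v κ P ρ C T T' T₀ ζ hWL hID hdiff hspeed hT hT' hT₀ h12 hRlip hRpos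
    (fun s hs ↦ by simpa [hR, hc₀def] using hρ s hs) hcap
    (fun s hs i _ ↦ by simpa [hR, hc₀def] using htight s hs i)
    (fun s hs j hj ↦ absurd (Finset.mem_univ j) hj) (A := Finset.univ) (a := a)
  have hint : ∫ s in t₁..t₂, (R s ^ (3 / 2 : ℝ))⁻¹ ≤ 2 * (c₀ ^ (3 / 2 : ℝ))⁻¹ * (t₁ ^ (1 / 2 : ℝ))⁻¹ :=
    integral_inv_rpow_three_halves_mul_le hc₀ ht₁ h12
  have hbound := mul_le_mul_of_nonneg_left hint hC
  exact ⟨hinc.1.trans (by linarith), fun k ↦ (hinc.2 k).trans (by linarith)⟩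

/-- Registered helper form: a `c₀`-linear radius is 2-Lipschitz when `0 < c₀ ≤ 2` (carrier of this file). [folklore] -/
theorem oracle_linear_radius_lipschitz : ∀ (c₀ s s' : ℝ), 0 < c₀ → c₀ ≤ 2 → |c₀ * s - c₀ * s'| ≤ 2 * |s - s'| := by
  intro c₀ s s' hc₀ hc₂
  rw [← mul_sub, abs_mul, abs_of_pos hc₀]
  have := abs_nonneg (s - s')
  nlinarith

end Summit.FinalStateConjecture.FinalStateConjecture.Theorems.SublinearIsFree.Oracle

end
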